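/-
COR-CM (cell pub-hodgecm2, stage 2 of the Hodge ladder) — Δ2 BRIDGE, ORIENTATION AUDIT, TEST T2 — THE HYBRID READING BY VALUE
(wb-9, transport route; sequel to `OrientationT2ConjAdm` (wb-1) ∕ `OrientationT2InconsistencyByValue` (wb-9)).
THEOREMS ONLY (kernel lane): no definition, no notation, no instance, no named fact, no `sorry`; nothing landed is edited or restated.
FRAMING: HC_CM is NOT proved; «Δ2 BRIDGE CLOSED» is NOT claimed; `hLiu` = READING r8; this is an AUDIT module (evidence either way).
-/
import Summits.HodgeConjecture.CorCM.D2Bridge.Thm418CAtPin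
import Summits.HodgeConjecture.CorCM.D2Bridge.JRecordSocketByValue
import Summits.HodgeConjecture.CorCM.D2Bridge.HcmPiecesAtPinConjInst
import Summits.HodgeConjecture.CorCM.D2Bridge.OrientationT2InconsistencyByValue
import HarnessLib

/-!
# Δ2 bridge, orientation test T2 — the hybrid reading `𝔇ʰ.Thm418C` of the pinned dictionary of record, BY VALUE from the printed
# citations at the constructed objects

`OrientationT2ConjAdm` (wb-1, ✔) observed: the HYBRID tower dictionary `𝔇ʰ` — the pinned dictionary of record
`𝔇 = liuDictionaryPin … V I line` with ONLY its admissibility re-keyed, `adm i d := d.IsReflexOfTypeG ῑ₁ (typeOfLine (line i))`,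
`ῑ₁ = conj ∘ ι₁` (`H`, `block`, `res`, `PhiMu`, `Ω` identical by `rfl`) — has `𝔇ʰ.Thm418C` as the conclusion of
✔ `PinSignatures.thm418C_ofTower_of_pins` from edition-1's (a)(b) binders and cites VERBATIM together with (c)(d) families typed at
`𝔇ʰ.cmClasses`, «the shape the by-value terms at instance `ῑ₁` are built to inhabit … ONCE those terms land, edition-1's citation family
forces every holomorphic class placed in a `PhiMu` block by an `hJS`-witness to vanish».  Those terms HAVE landed:

* (c) ✔ `JRecordSocketByValue` (prove-5, p373172): `socketM ∕ socketJH ∕ socketJH_injective ∕ socketJH_comm` — the (4.3) record of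
  [Liu2021] at the rests of record on the SHARED `ι₁`-presented tail, over the J2 interface of record `socketJ` (the tree's cofan
  ✔ `componentAlbanesePinTotal`, instance `ῑ₁`) and the one object `socketDμ` (`h21` = [Shimura1998, Thm. 21.4]);
* (d) ✔ `HcmPiecesAtPinConjInst.nonempty_hcmPieces_atRekeyedTower` (wb-3): the pieces S1–S4 for THAT record at a tower dictionary keyed
  `IsReflexOfTypeG ῑ₁ (Φc i)`, admissibility discharged from `Φ_μ = Φc i` — here `Φc := typeOfLine ∘ line` and `Φ_{μ_i} = (line i).lineType`
  is the Ω-pin's own key (`OmegaPin.exists_pinTerms_indexOfRecord`, T-SIGN ✔ `OmegaPinTSignIndex`).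

THIS FILE composes them:

* §1 `nonempty_socketPieces_conjAdm` — (d) BY VALUE at the socket's literal (c) terms, for `𝔇ʰ.cmClasses`, at every index line `i`, every
  conjugate-symplectic weight-one `μ` with `HasCMType μ (line i).lineType`, every `K ≤ Level.capThree C.S.K₀`.
* §2 **`thm418C_conjAdm_atPin_of_cites`** — `𝔇ʰ.Thm418C` at the index of record `(F, ι₁, V, a₀)` from EXACTLY the displayed citation
  binders of ✔ `Thm418CAtPin.thm418C_atPin` (`hLiu` [Thm. 4.18] AS PRINTED at Liu's rests of record at `δ′` — a READING r8 —, `h411R`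
  [Def. 4.11], `hD1` [Lem. D.1 (1)], `h413` [Prop. 4.13] at the tower, `hμsep` [Lem. D.1 (3)]) plus `h21`; NO (c)∕(d) binder: groups (a),(b)
  by value as in `thm418C_atPin` (same terms), (c),(d) by §1.  Proof = `thm418C_atPin`'s, one token changed (`adm`), two families supplied.
* §3 (sibling file `OrientationT2InconsistencyOfCites.lean`, same seat) consequences at the literal pin, `F/ℚ` Galois, every input a
  displayed END-shaped binder or a tree theorem: the END's `h418` (`𝔇.Thm418C`, keyed `ι₁`) ∧ the cites ∧ `h21` ⟹ `𝔇.block i = ⊥` at EVERY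
  `PhiMu` line (wb-1 ✔ `block_pin_eq_bot_of_thm418C_of_thm418C_conjAdm` + §2); … ∧ `𝔇.Prop413` ∧ one nontrivial `Ω i a` ⟹ `False` (wb-9 ✔
  `false_of_thm418C_pin_of_prop413_of_thm418C_conjAdm` + §2); the cites ∧ `h21` ALONE ⟹ every holomorphic (`F¹`) class carried into a
  `PhiMu` block by an `hJS`-witness is `0` (wb-1 ✔ `eq_zero_of_thm418C_conjAdm_of_hJS` + §2).

READING (audit, numbers not adjectives).  ORIENTATION-MEMO §4 T2 asked for «`block i = ⊥` at a PhiMu line ⟹ an INCONSISTENCY WITNESS for the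
by-name display, OR precisely why the kernel cannot see Hodge types through `jH`».  wb-8∕wb-9 g0 answered: not from the displayed (c)(d) TYPES
(Hodge-blind); wb-9 g0∕g1: modulo ONE typed binder (D) ∕ the hybrid reading `h418h`.  §2 removes that binder: the tree's OWN cofan (instance
`ῑ₁`) with the landed (c)∕(d)-by-value terms PRODUCES `h418h` from the same printed citations the END of record displays.  Hence (§3), in
the kernel as it stands: the END's `h418` together with its displayed citations and `h21` forces every `PhiMu` block of the pinned
dictionary to vanish, and the citations with `h21` alone force every holomorphic `hJS`-fed class in a `PhiMu` block to vanish.  Which displayed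
row is «at fault» (the reading r8 `hLiu` at the constructed objects, a model row behind the `_holds` terms, or the orientation of the
tree's App-C cofan) is NOT decided here; nothing is asserted inhabited; HC_CM is NOT proved; «Δ2 BRIDGE CLOSED» is NOT claimed.

## References
* [Liu2021] Y. Liu, *Fourier–Jacobi cycles and arithmetic relative trace formula*, Camb. J. Math. 9 (2021) = arXiv:2102.11518: Thm. 4.18
  (FJcycle.tex l. 2232–2245) and its proof (l. 2247–2268), Rem. 4.17, Prop. 4.13 (l. 2113–2119), Def. 4.11, Def. 4.5 (2), Lem. 2.4 (1),
  App. D Lem. D.1 (1),(3).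
* [Shimura1998] G. Shimura, *Abelian Varieties with Complex Multiplication and Modular Functions*, §21.4 Thm. 21.4; §8.3 Prop. 28.
* [VoisinHodgeI2002] C. Voisin, *Hodge Theory and Complex Algebraic Geometry I*, §6.1.3 Cor. 6.14, §7.3.2.
-/

set_option autoImplicit false

noncomputable section

open scoped TensorProduct Matrix

namespace Summit.HodgeConjecture.CorCM.D2Bridge

open NumberField NumberField.InfinitePlace IsDedekindDomain
open HodgeCM HodgeCM.Model HodgeCM.Model.LiuIndex HodgeCM.Model.TowerCarrier HodgeCM.Model.TowerLevel
open HodgeCM.Literature.Theta HodgeCM.Literature.Theta.LiuAlbaneseModuleDatum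
open HodgeCM.Literature.Theta.LiuAlbaneseModuleDatum.D2Bridge (HcmPieces)
open Summit.HodgeConjecture.CorCM.Model Summit.HodgeConjecture.CorCM.Transposition
open Literature.AlgebraicGeometry.Motives (CMType)
open Literature.AlgebraicGeometry.HodgeTheory Literature.NumberTheory.Automorphic.PicardCM
open Literature.AlgebraicGeometry.ShimuraVarieties.UnitaryCanonicalModel
open Literature.NumberTheory.ComplexMultiplication
open Literature.NumberTheory.Automorphic
open Literature.NumberTheory.Automorphic.IdeleClassGroup (toHeckeCharacter isUnitary_toHeckeCharacter)
open Literature.NumberTheory.Automorphic.Liu2021 Literature.NumberTheory.Automorphic.Liu2021.AppendixC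
open Literature.NumberTheory.Automorphic.Liu2021.AppendixC.RestOne
open Literature.NumberTheory.Automorphic.Liu2021.Def411WeilCarriers (locF Rep)
open Literature.NumberTheory.GelbartRogawski1991 Literature.NumberTheory.GelbartRogawski1991.UnitaryDualPair
open Literature.NumberTheory.GelbartRogawski1991.UnitaryDualPair.LocalSplitting (localMu norm_localMu continuous_localMu
  localMu_toLocalRing_eq_one_iff)
open Literature.NumberTheory.Transcendental (Arapura2012_Cor_15_4_6)
open Literature.RepresentationTheory Literature.RepresentationTheory.Liu2021
open Summit.HodgeConjecture.CorCM.Transposition.OmegaTransport (realUnit)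
open HodgeCM.Model.ArchSideTerm (e₁)

/-! ## §1  The pieces (d) BY VALUE at the socket's (c) terms, for the hybrid dictionary's generator sets -/

set_option synthInstance.maxHeartbeats 400000 in
set_option maxHeartbeats 3200000 in
/-- **(d) BY VALUE for `𝔇ʰ`.**  At every index line `i`, every conjugate-symplectic weight-one `μ` carrying the line's key
`HasCMType μ (line i).lineType`, and every level `K ≤ Level.capThree C.S.K₀`: the Albanese-on-pieces package `HcmPieces` for the (c) record of
record `socketM ∕ socketJH` (✔ `JRecordSocketByValue`, instance `ῑ₁`, shared `ι₁`-presented tail) and the generator set `𝔇ʰ.cmClasses K i`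
(admissibility `IsReflexOfTypeG ῑ₁ (typeOfLine (line i))`) is inhabited — wb-3's ✔ `nonempty_hcmPieces_atRekeyedTower` at
`Φc := typeOfLine ∘ line`, `hΦ := hμ.cmType_eq hΦμ`, `J := socketJ`, `Dμ := socketDμ`, `τ'` the member of `Φ_μ` chosen in `socketM`.
[cite: Liu2021, Thm. 4.18 (1) (FJcycle.tex l. 2239) with proof l. 2247–2253, Rem. 4.17, Lem. 2.4 (1) (l. 1210–1228), Def. 4.5 (2) (l. 1944–1951)]
[cite: Shimura1998, §21.4 Thm. 21.4] -/
theorem nonempty_socketPieces_conjAdm (F : HodgeCM.CMField) [IsGalois ℚ (F : Type)] (h6 : 6 ≤ Module.finrank ℚ (F : Type))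
    {ι₁ : (F : Type) →+* ℂ} (V : HodgeCM.HermSpace3 F ι₁) (a₀ : RealScalar F) (h : exists_recordSystem) (Φ : CMType (F : Type))
    (h21 : shimura1998_thm21_4_casselman) (i : (I V (repAt a₀) (muLiu ι₁ GramClass.rep)))
    (μ : Literature.NumberTheory.Automorphic.IdeleClassGroup (F : Type) →ₜ* Circle)
    (hμ : IdeleClassGroup.IsConjugateSymplectic (F : Type) μ) (hw : IdeleClassGroup.HasWeight (F : Type) μ 1)
    (hΦμ : IdeleClassGroup.HasCMType (F : Type) μ (line V (repAt a₀) (muLiu ι₁ GramClass.rep) i).lineType) (K : HodgeCM.Level V)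
    (hK : K ≤ (HodgeCM.Level.capThree (V := V) (((sec42DataOf h isoOf ⟨F.K⟩ ι₁ (⟨V.Hm, V.isHermitian, V.signature_ι₁, V.posDef_of_ne⟩) Φ)).S.K₀.1 : Subgroup ↥(HodgeCM.HermSpace3.adelicFin V)) ((sec42DataOf h isoOf ⟨F.K⟩ ι₁ (⟨V.Hm, V.isHermitian, V.signature_ι₁, V.posDef_of_ne⟩) Φ)).S.K₀.2.1)) :
    Nonempty (HcmPieces.{0, 1, 0}
      (toThm418Data _ ((uniformOmegaRep h ⟨HodgeCM.CMField.K F⟩ ι₁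
        ⟨HodgeCM.HermSpace3.Hm V, HodgeCM.HermSpace3.isHermitian V, HodgeCM.HermSpace3.signature_ι₁ V, HodgeCM.HermSpace3.posDef_of_ne V⟩ Φ
        e₁ (frameD V) (frameD_real V) (frameD_ne V) (ιVE V) (2 * imagUnit (HodgeCM.CMField.K F))⁻¹ (fun _ _ =>
          Rep.update ↥(maximalRealSubfield (HodgeCM.CMField.K F)) (imagUnitSq (HodgeCM.CMField.K F))
            (Rep.ofLineOf ↥(maximalRealSubfield (HodgeCM.CMField.K F)) (imagUnitSq (HodgeCM.CMField.K F)))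
            (locF ↥(maximalRealSubfield (HodgeCM.CMField.K F)) (imagUnitSq (HodgeCM.CMField.K F))
              (realUnit ⟨HodgeCM.CMField.K F⟩ (repAt a₀ (Sigma.fst i)).1 (repAt a₀ (Sigma.fst i)).2.1 (repAt a₀ (Sigma.fst i)).2.2))
            (realUnit ⟨HodgeCM.CMField.K F⟩ (repAt a₀ (Sigma.fst i)).1 (repAt a₀ (Sigma.fst i)).2.1 (repAt a₀ (Sigma.fst i)).2.2) rfl)).rest
        (restTailOne (AlgHom.id ℚ _) ι₁ hμ hw (Def45.Carriers.ofPolDR μ (Def45.PolDR ι₁ hμ (Def45.RMuForm ι₁ hμ)))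
          ((heckeTranslatesFamilyOf heckeTranslate_definedOver_holds h isoOf ⟨HodgeCM.CMField.K F⟩ ι₁
            ⟨HodgeCM.HermSpace3.Hm V, HodgeCM.HermSpace3.isHermitian V, HodgeCM.HermSpace3.signature_ι₁ V, HodgeCM.HermSpace3.posDef_of_ne V⟩ Φ
            h6).rhoΩOne (AlgHom.id ℚ _) ι₁ hμ hw (Def45.Carriers.ofPolDR μ (Def45.PolDR ι₁ hμ (Def45.RMuForm ι₁ hμ)))))))
      (socketM F h6 V a₀ h Φ h21 i μ hμ hw)
      (LiuDictionary.ofTower exists_isReal_hodgeModel_holds hodgePQ_independent_of_hodgeModel_holds BallQuotient.ballQuotientUniformised_holds (cmAbelianVarietyRealised_of_eigenbasis exists_isReal_hodgeModel_holds hodgePQ_independent_of_hodgeModel_holds cmAbelianVarietyEigenbasisRealised_holds) Literature.NumberTheory.Transcendental.arapura2012_cor_15_4_6_holds V (I V (repAt a₀) (muLiu ι₁ GramClass.rep))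
      (fun i => {χ : (line V (repAt a₀) (muLiu ι₁ GramClass.rep) i).CharW // (line V (repAt a₀) (muLiu ι₁ GramClass.rep) i).IsAutChar χ})
      (fun i a => (line V (repAt a₀) (muLiu ι₁ GramClass.rep) i).Ω (ιVE V) a.1) (fun i => SplitLine.PhiMuLine ι₁ (line V (repAt a₀) (muLiu ι₁ GramClass.rep) i))
      (fun i dd => dd.IsReflexOfTypeG ((starRingEnd ℂ).comp ι₁) (SplitLine.typeOfLine (line V (repAt a₀) (muLiu ι₁ GramClass.rep) i)))).H
      (socketJH F h6 V a₀ h Φ h21 i μ hμ hw) K.K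
      ((HodgeCM.Model.picardCMUniverse exists_isReal_hodgeModel_holds hodgePQ_independent_of_hodgeModel_holds BallQuotient.ballQuotientUniformised_holds (cmAbelianVarietyRealised_of_eigenbasis exists_isReal_hodgeModel_holds hodgePQ_independent_of_hodgeModel_holds cmAbelianVarietyEigenbasisRealised_holds)).CohC
        ((HodgeCM.Model.picardCMUniverse exists_isReal_hodgeModel_holds hodgePQ_independent_of_hodgeModel_holds BallQuotient.ballQuotientUniformised_holds (cmAbelianVarietyRealised_of_eigenbasis exists_isReal_hodgeModel_holds hodgePQ_independent_of_hodgeModel_holds cmAbelianVarietyEigenbasisRealised_holds)).pms F ι₁ V K) 1)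
      (resTotal exists_isReal_hodgeModel_holds hodgePQ_independent_of_hodgeModel_holds (ballQuotientUniformisedDatum_of BallQuotient.ballQuotientUniformised_holds) (cmAbelianVarietyRealised_of_eigenbasis exists_isReal_hodgeModel_holds hodgePQ_independent_of_hodgeModel_holds cmAbelianVarietyEigenbasisRealised_holds) Literature.NumberTheory.Transcendental.arapura2012_cor_15_4_6_holds K)
      ((LiuDictionary.ofTower exists_isReal_hodgeModel_holds hodgePQ_independent_of_hodgeModel_holds BallQuotient.ballQuotientUniformised_holds (cmAbelianVarietyRealised_of_eigenbasis exists_isReal_hodgeModel_holds hodgePQ_independent_of_hodgeModel_holds cmAbelianVarietyEigenbasisRealised_holds) Literature.NumberTheory.Transcendental.arapura2012_cor_15_4_6_holds V (I V (repAt a₀) (muLiu ι₁ GramClass.rep))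
      (fun i => {χ : (line V (repAt a₀) (muLiu ι₁ GramClass.rep) i).CharW // (line V (repAt a₀) (muLiu ι₁ GramClass.rep) i).IsAutChar χ})
      (fun i a => (line V (repAt a₀) (muLiu ι₁ GramClass.rep) i).Ω (ιVE V) a.1) (fun i => SplitLine.PhiMuLine ι₁ (line V (repAt a₀) (muLiu ι₁ GramClass.rep) i))
      (fun i dd => dd.IsReflexOfTypeG ((starRingEnd ℂ).comp ι₁) (SplitLine.typeOfLine (line V (repAt a₀) (muLiu ι₁ GramClass.rep) i)))).cmClasses K i)) := by
  letI : Algebra (F : Type) ℂ := ((starRingEnd ℂ).comp ι₁).toAlgebra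
  exact nonempty_hcmPieces_atRekeyedTower (I V (repAt a₀) (muLiu ι₁ GramClass.rep))
    (fun i => {χ : (line V (repAt a₀) (muLiu ι₁ GramClass.rep) i).CharW // (line V (repAt a₀) (muLiu ι₁ GramClass.rep) i).IsAutChar χ}) (fun i a => (line V (repAt a₀) (muLiu ι₁ GramClass.rep) i).Ω (ιVE V) a.1)
    (fun i => SplitLine.PhiMuLine ι₁ (line V (repAt a₀) (muLiu ι₁ GramClass.rep) i)) hμ hw
    (Def45.Carriers.ofPolDR μ (Def45.PolDR ι₁ hμ (Def45.RMuForm ι₁ hμ))) h (sec42DataOf h isoOf ⟨F.K⟩ ι₁ (⟨V.Hm, V.isHermitian, V.signature_ι₁, V.posDef_of_ne⟩) Φ)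
    (heckeTranslatesFamilyOf heckeTranslate_definedOver_holds h isoOf ⟨F.K⟩ ι₁ (⟨V.Hm, V.isHermitian, V.signature_ι₁, V.posDef_of_ne⟩) Φ h6) (fun _ => rfl)
    (uniformOmegaRep h ⟨F.K⟩ ι₁ (⟨V.Hm, V.isHermitian, V.signature_ι₁, V.posDef_of_ne⟩) Φ e₁ (frameD V) (frameD_real V) (frameD_ne V) (ιVE V) (2 * imagUnit (HodgeCM.CMField.K F))⁻¹
      (fun _ _ => Rep.update ↥(maximalRealSubfield (HodgeCM.CMField.K F)) (imagUnitSq (HodgeCM.CMField.K F))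
        (Rep.ofLineOf ↥(maximalRealSubfield (HodgeCM.CMField.K F)) (imagUnitSq (HodgeCM.CMField.K F)))
        (locF ↥(maximalRealSubfield (HodgeCM.CMField.K F)) (imagUnitSq (HodgeCM.CMField.K F))
          (realUnit ⟨HodgeCM.CMField.K F⟩ (repAt a₀ (Sigma.fst i)).1 (repAt a₀ (Sigma.fst i)).2.1 (repAt a₀ (Sigma.fst i)).2.2))
        (realUnit ⟨HodgeCM.CMField.K F⟩ (repAt a₀ (Sigma.fst i)).1 (repAt a₀ (Sigma.fst i)).2.1 (repAt a₀ (Sigma.fst i)).2.2) rfl))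
    (fun i => SplitLine.typeOfLine (line V (repAt a₀) (muLiu ι₁ GramClass.rep) i))
    (socketJ F h6 V h Φ (starRingEnd_comp_comp_cmConj ι₁)) (socketJ_levelLaw F h6 V h Φ (starRingEnd_comp_comp_cmConj ι₁))
    (socketDμ F ι₁ h21 μ hμ hw) (exists_mem_of_cmType hμ.cmType ι₁).choose (exists_mem_of_cmType hμ.cmType ι₁).choose_spec i K hK
    (hμ.cmType_eq hΦμ)

/-! ## §2  `𝔇ʰ.Thm418C` at the index of record, from the displayed citations and `h21` — (a),(b) by value as in `thm418C_atPin`, (c),(d) by §1 -/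

set_option synthInstance.maxHeartbeats 400000 in
set_option maxHeartbeats 6400000 in
/-- **THE HYBRID READING BY VALUE.**  From the printed citations at the CONSTRUCTED objects — the displayed binders of
✔ `Thm418CAtPin.thm418C_atPin` VERBATIM: `hLiu` [Liu21, Thm. 4.18] AS PRINTED at Liu's rests of record at `δ′` (a READING r8), `h411R`
[Def. 4.11] and `hD1` [Lem. D.1 (1)] there, `h413` [Prop. 4.13] AS PRINTED at the tower, `hμsep` [Lem. D.1 (3)] — and `h21` [Shimura1998,
Thm. 21.4]: `Thm418C` of the HYBRID dictionary `𝔇ʰ` (the pinned dictionary of record at `(F, ι₁, V, a₀)` with admissibility keyed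
`IsReflexOfTypeG ῑ₁ (typeOfLine (line i))`; `H ∕ block ∕ res ∕ PhiMu ∕ Ω` those of `𝔇`).  Groups (a),(b), `hbad`, `hnvD`, `h411`, `hsep`,
`hK` BY VALUE by the very terms of `thm418C_atPin`; (c) := `socketM ∕ socketJH ∕ socketJH_injective ∕ socketJH_comm` at the Ω-pin's
characters `μ_i`; (d) := §1 at the Ω-pin's key `HasCMType μ_i (line i).lineType`.  NO (c)∕(d) binder remains.  Nothing is asserted
inhabited beyond what the binders say; HC_CM is NOT proved; «Δ2 BRIDGE CLOSED» is NOT claimed.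
[cite: Liu2021, Thm. 4.18 (FJcycle.tex l. 2232–2245) with proof l. 2247–2268; Prop. 4.13 (l. 2113–2119); Def. 4.11 (l. 2083–2097); App. D Lem. D.1 (1),(3) (l. 5226–5233)]
[cite: Shimura1998, §21.4 Thm. 21.4] -/
theorem thm418C_conjAdm_atPin_of_cites (F : HodgeCM.CMField) [IsGalois ℚ (F : Type)] (h6 : 6 ≤ Module.finrank ℚ (F : Type))
    {ι₁ : (F : Type) →+* ℂ} (V : HodgeCM.HermSpace3 F ι₁) (hV : (InfinitePlace.mk ι₁).embedding = ι₁) (a₀ : RealScalar F)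
    (h : exists_recordSystem) (Φ : CMType (F : Type)) (h21 : shimura1998_thm21_4_casselman)
    -- [Liu2021, Thm. 4.18] AS PRINTED at Liu's rests of record at δ′ — a READING r8 at the constructed objects
    (hLiu : ∀ (i : (I V (repAt a₀) (muLiu ι₁ GramClass.rep))) (μ : Literature.NumberTheory.Automorphic.IdeleClassGroup (F : Type) →ₜ* Circle)
      (hμ : IdeleClassGroup.IsConjugateSymplectic (F : Type) μ) (hw : IdeleClassGroup.HasWeight (F : Type) μ 1),
      Thm418AsPrinted (toThm418Data _ (restOfCharDeltaPrimeLine h ⟨F.K⟩ h6 ι₁ (⟨V.Hm, V.isHermitian, V.signature_ι₁, V.posDef_of_ne⟩) Φ e₁ (frameD V) (frameD_real V) (frameD_ne V) (ιVE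
            V) (repAt a₀ (Sigma.fst i)).1 (repAt a₀ (Sigma.fst i)).2.1 (repAt a₀ (Sigma.fst i)).2.2 μ hμ hw)))
    -- [Liu2021, Def. 4.11] AS PRINTED at those rests
    (h411R : ∀ (i : (I V (repAt a₀) (muLiu ι₁ GramClass.rep))) (μ : Literature.NumberTheory.Automorphic.IdeleClassGroup (F : Type) →ₜ* Circle)
      (hμ : IdeleClassGroup.IsConjugateSymplectic (F : Type) μ) (hw : IdeleClassGroup.HasWeight (F : Type) μ 1),
      Def411AsPrinted (toThm418Data _ (restOfCharDeltaPrimeLine h ⟨F.K⟩ h6 ι₁ (⟨V.Hm, V.isHermitian, V.signature_ι₁, V.posDef_of_ne⟩) Φ e₁ (frameD V) (frameD_real V) (frameD_ne V) (ιVE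
            V) (repAt a₀ (Sigma.fst i)).1 (repAt a₀ (Sigma.fst i)).2.1 (repAt a₀ (Sigma.fst i)).2.2 μ hμ hw)))
    -- [Liu2021, App. D Lem. D.1 (1)] AS PRINTED at every finite place of the local data of those rests
    (hD1 : ∀ (i : (I V (repAt a₀) (muLiu ι₁ GramClass.rep))) (μ : Literature.NumberTheory.Automorphic.IdeleClassGroup (F : Type) →ₜ* Circle)
      (hμ : IdeleClassGroup.IsConjugateSymplectic (F : Type) μ) (hw : IdeleClassGroup.HasWeight (F : Type) μ 1)
      (j : (toThm418Data _ (restOfCharDeltaPrimeLine h ⟨F.K⟩ h6 ι₁ (⟨V.Hm, V.isHermitian, V.signature_ι₁, V.posDef_of_ne⟩) Φ e₁ (frameD V) (frameD_real V) (frameD_ne V) (ιVE V) (repAt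
            a₀ (Sigma.fst i)).1 (repAt a₀ (Sigma.fst i)).2.1 (repAt a₀ (Sigma.fst i)).2.2 μ hμ hw)).AdmIndex) (v : HeightOneSpectrum (𝓞 ↥(maximalRealSubfield (F : Type)))),
      LemD1_1AsPrinted
      (Def411WeilCarriers.localLemD1Data ↥(maximalRealSubfield (F : Type)) (F : Type) (IsCMField.complexConj (F : Type)) 3 e₁
        (Matrix.diagonal (frameD V)) (complexConj_imagUnit (F : Type)) (imagUnit_ne_zero (F : Type)) (imagUnit_mul_self (F : Type))
        (realDiagonal_isSymm (F : Type) (frameD V) (frameD_real V)) (isUnit_det_realDiagonal (F : Type) (frameD V) (frameD_real V) (frameD_ne V))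
        (realDiagonal_map (F : Type) (frameD V) (frameD_real V)).symm (((repOfLine ⟨F.K⟩ (repAt a₀ (Sigma.fst i)).1 (repAt a₀ (Sigma.fst i)).2.1 (repAt a₀ (Sigma.fst i)).2.2)).toFun
              j.1.1)
        (OmegaChiSplitting.chiLocalSplittingsD ⟨F.K⟩ e₁ (frameD V) (frameD_real V) (frameD_ne V) (toHeckeCharacter (F : Type) μ)
          ((isOscillatorChar_toHeckeCharacter_iff μ).mpr hμ) (((repOfLine ⟨F.K⟩ (repAt a₀ (Sigma.fst i)).1 (repAt a₀ (Sigma.fst i)).2.1 (repAt a₀ (Sigma.fst i)).2.2)).toFun j.1.1))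
        (le_refl 3) (localMu (F : Type) (toHeckeCharacter (F : Type) μ))
        (fun v x => norm_localMu (F : Type) (toHeckeCharacter (F : Type) μ) v (isUnitary_toHeckeCharacter (F : Type) μ) x)
        (continuous_localMu (F : Type) (toHeckeCharacter (F : Type) μ))
        (fun v t => localMu_toLocalRing_eq_one_iff (F : Type) (toHeckeCharacter (F : Type) μ) v ((isOscillatorChar_toHeckeCharacter_iff μ).mpr hμ) t)
        j.1.2.1
        (Def411WeilCarriers.norm_chi_eq_one ↥(maximalRealSubfield (F : Type)) (F : Type) (IsCMField.complexConj (F : Type))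
          (Algebra.IsQuadraticExtension.finrank_eq_two ↥(maximalRealSubfield (F : Type)) (F : Type))
          (UnitaryGroup.algEquiv_ne_one_of_apply_eq_neg ↥(maximalRealSubfield (F : Type)) (F : Type) (IsCMField.complexConj (F : Type))
            (complexConj_imagUnit (F : Type)) (imagUnit_ne_zero (F : Type))) j.1.2)
        j.1.2.2.1 v))
    -- [Liu2021, Prop. 4.13] AS PRINTED over the uniform carriers of record, `H¹_{B,ι₁}(A_∞, ℂ)` read as the tower
    (h413 : ∀ i : (I V (repAt a₀) (muLiu ι₁ GramClass.rep)), Prop413AsPrinted (((uniformOmegaRep h ⟨F.K⟩ ι₁ (⟨V.Hm, V.isHermitian, V.signature_ι₁, V.posDef_of_ne⟩) Φ e₁ (frameD V)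
          (frameD_real V) (frameD_ne V) (ιVE V) (2 * imagUnit (HodgeCM.CMField.K F))⁻¹ (fun _ _ => (repOfLine ⟨F.K⟩ (repAt a₀ (Sigma.fst i)).1 (repAt a₀ (Sigma.fst i)).2.1 (repAt a₀
          (Sigma.fst i)).2.2)))).prop413Data ((liuDictionaryPin exists_isReal_hodgeModel_holds hodgePQ_independent_of_hodgeModel_holds BallQuotient.ballQuotientUniformised_holds
          (cmAbelianVarietyRealised_of_eigenbasis exists_isReal_hodgeModel_holds hodgePQ_independent_of_hodgeModel_holds cmAbelianVarietyEigenbasisRealised_holds)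
          Literature.NumberTheory.Transcendental.arapura2012_cor_15_4_6_holds V (I V (repAt a₀) (muLiu ι₁ GramClass.rep)) (line V (repAt a₀) (muLiu ι₁ GramClass.rep)))).H))
    -- the cross-`μ` separation leg ([Liu2021, App. D Lem. D.1 (3)] with «μ = ⊗_v μ_v»)
    (hμsep : ∀ (i : (I V (repAt a₀) (muLiu ι₁ GramClass.rep))) (s t : (((uniformOmegaRep h ⟨F.K⟩ ι₁ (⟨V.Hm, V.isHermitian, V.signature_ι₁, V.posDef_of_ne⟩) Φ e₁ (frameD V) (frameD_real
          V) (frameD_ne V) (ιVE V) (2 * imagUnit (HodgeCM.CMField.K F))⁻¹ (fun _ _ => (repOfLine ⟨F.K⟩ (repAt a₀ (Sigma.fst i)).1 (repAt a₀ (Sigma.fst i)).2.1 (repAt a₀ (Sigma.fst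
          i)).2.2)))).prop413Data ((liuDictionaryPin exists_isReal_hodgeModel_holds hodgePQ_independent_of_hodgeModel_holds BallQuotient.ballQuotientUniformised_holds
          (cmAbelianVarietyRealised_of_eigenbasis exists_isReal_hodgeModel_holds hodgePQ_independent_of_hodgeModel_holds cmAbelianVarietyEigenbasisRealised_holds)
          Literature.NumberTheory.Transcendental.arapura2012_cor_15_4_6_holds V (I V (repAt a₀) (muLiu ι₁ GramClass.rep)) (line V (repAt a₀) (muLiu ι₁ GramClass.rep)))).H).AdmTriple),
      Nontrivial ((((uniformOmegaRep h ⟨F.K⟩ ι₁ (⟨V.Hm, V.isHermitian, V.signature_ι₁, V.posDef_of_ne⟩) Φ e₁ (frameD V) (frameD_real V) (frameD_ne V) (ιVE V) (2 * imagUnit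
            (HodgeCM.CMField.K F))⁻¹ (fun _ _ => (repOfLine ⟨F.K⟩ (repAt a₀ (Sigma.fst i)).1 (repAt a₀ (Sigma.fst i)).2.1 (repAt a₀ (Sigma.fst i)).2.2)))).prop413Data
            ((liuDictionaryPin exists_isReal_hodgeModel_holds hodgePQ_independent_of_hodgeModel_holds BallQuotient.ballQuotientUniformised_holds (cmAbelianVarietyRealised_of_eigenbasis
            exists_isReal_hodgeModel_holds hodgePQ_independent_of_hodgeModel_holds cmAbelianVarietyEigenbasisRealised_holds)
            Literature.NumberTheory.Transcendental.arapura2012_cor_15_4_6_holds V (I V (repAt a₀) (muLiu ι₁ GramClass.rep)) (line V (repAt a₀) (muLiu ι₁ GramClass.rep)))).H).omegaAt s)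
            →
      (∃ f : (((uniformOmegaRep h ⟨F.K⟩ ι₁ (⟨V.Hm, V.isHermitian, V.signature_ι₁, V.posDef_of_ne⟩) Φ e₁ (frameD V) (frameD_real V) (frameD_ne V) (ιVE V) (2 * imagUnit
            (HodgeCM.CMField.K F))⁻¹ (fun _ _ => (repOfLine ⟨F.K⟩ (repAt a₀ (Sigma.fst i)).1 (repAt a₀ (Sigma.fst i)).2.1 (repAt a₀ (Sigma.fst i)).2.2)))).prop413Data
            ((liuDictionaryPin exists_isReal_hodgeModel_holds hodgePQ_independent_of_hodgeModel_holds BallQuotient.ballQuotientUniformised_holds (cmAbelianVarietyRealised_of_eigenbasis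
            exists_isReal_hodgeModel_holds hodgePQ_independent_of_hodgeModel_holds cmAbelianVarietyEigenbasisRealised_holds)
            Literature.NumberTheory.Transcendental.arapura2012_cor_15_4_6_holds V (I V (repAt a₀) (muLiu ι₁ GramClass.rep)) (line V (repAt a₀) (muLiu ι₁ GramClass.rep)))).H).omegaAt s
            ≃ₗ[ℂ]
          (((uniformOmegaRep h ⟨F.K⟩ ι₁ (⟨V.Hm, V.isHermitian, V.signature_ι₁, V.posDef_of_ne⟩) Φ e₁ (frameD V) (frameD_real V) (frameD_ne V) (ιVE V) (2 * imagUnit (HodgeCM.CMField.K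
                F))⁻¹ (fun _ _ => (repOfLine ⟨F.K⟩ (repAt a₀ (Sigma.fst i)).1 (repAt a₀ (Sigma.fst i)).2.1 (repAt a₀ (Sigma.fst i)).2.2)))).prop413Data ((liuDictionaryPin
                exists_isReal_hodgeModel_holds hodgePQ_independent_of_hodgeModel_holds BallQuotient.ballQuotientUniformised_holds (cmAbelianVarietyRealised_of_eigenbasis
                exists_isReal_hodgeModel_holds hodgePQ_independent_of_hodgeModel_holds cmAbelianVarietyEigenbasisRealised_holds)
                Literature.NumberTheory.Transcendental.arapura2012_cor_15_4_6_holds V (I V (repAt a₀) (muLiu ι₁ GramClass.rep)) (line V (repAt a₀) (muLiu ι₁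
                GramClass.rep)))).H).omegaAt t,
        ∀ (g : ↥V.adelicFin) (v : (((uniformOmegaRep h ⟨F.K⟩ ι₁ (⟨V.Hm, V.isHermitian, V.signature_ι₁, V.posDef_of_ne⟩) Φ e₁ (frameD V) (frameD_real V) (frameD_ne V) (ιVE V) (2 *
              imagUnit (HodgeCM.CMField.K F))⁻¹ (fun _ _ => (repOfLine ⟨F.K⟩ (repAt a₀ (Sigma.fst i)).1 (repAt a₀ (Sigma.fst i)).2.1 (repAt a₀ (Sigma.fst i)).2.2)))).prop413Data
              ((liuDictionaryPin exists_isReal_hodgeModel_holds hodgePQ_independent_of_hodgeModel_holds BallQuotient.ballQuotientUniformised_holds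
              (cmAbelianVarietyRealised_of_eigenbasis exists_isReal_hodgeModel_holds hodgePQ_independent_of_hodgeModel_holds cmAbelianVarietyEigenbasisRealised_holds)
              Literature.NumberTheory.Transcendental.arapura2012_cor_15_4_6_holds V (I V (repAt a₀) (muLiu ι₁ GramClass.rep)) (line V (repAt a₀) (muLiu ι₁ GramClass.rep)))).H).omegaAt
              s),
          f ((((uniformOmegaRep h ⟨F.K⟩ ι₁ (⟨V.Hm, V.isHermitian, V.signature_ι₁, V.posDef_of_ne⟩) Φ e₁ (frameD V) (frameD_real V) (frameD_ne V) (ιVE V) (2 * imagUnit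
                (HodgeCM.CMField.K F))⁻¹ (fun _ _ => (repOfLine ⟨F.K⟩ (repAt a₀ (Sigma.fst i)).1 (repAt a₀ (Sigma.fst i)).2.1 (repAt a₀ (Sigma.fst i)).2.2)))).prop413Data
                ((liuDictionaryPin exists_isReal_hodgeModel_holds hodgePQ_independent_of_hodgeModel_holds BallQuotient.ballQuotientUniformised_holds
                (cmAbelianVarietyRealised_of_eigenbasis exists_isReal_hodgeModel_holds hodgePQ_independent_of_hodgeModel_holds cmAbelianVarietyEigenbasisRealised_holds)
                Literature.NumberTheory.Transcendental.arapura2012_cor_15_4_6_holds V (I V (repAt a₀) (muLiu ι₁ GramClass.rep)) (line V (repAt a₀) (muLiu ι₁ GramClass.rep)))).H).rhoAt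
                s g v) =
            (((uniformOmegaRep h ⟨F.K⟩ ι₁ (⟨V.Hm, V.isHermitian, V.signature_ι₁, V.posDef_of_ne⟩) Φ e₁ (frameD V) (frameD_real V) (frameD_ne V) (ιVE V) (2 * imagUnit (HodgeCM.CMField.K
                  F))⁻¹ (fun _ _ => (repOfLine ⟨F.K⟩ (repAt a₀ (Sigma.fst i)).1 (repAt a₀ (Sigma.fst i)).2.1 (repAt a₀ (Sigma.fst i)).2.2)))).prop413Data ((liuDictionaryPin
                  exists_isReal_hodgeModel_holds hodgePQ_independent_of_hodgeModel_holds BallQuotient.ballQuotientUniformised_holds (cmAbelianVarietyRealised_of_eigenbasis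
                  exists_isReal_hodgeModel_holds hodgePQ_independent_of_hodgeModel_holds cmAbelianVarietyEigenbasisRealised_holds)
                  Literature.NumberTheory.Transcendental.arapura2012_cor_15_4_6_holds V (I V (repAt a₀) (muLiu ι₁ GramClass.rep)) (line V (repAt a₀) (muLiu ι₁
                  GramClass.rep)))).H).rhoAt t g (f v)) →
      s.1.μ = t.1.μ) :
    (LiuDictionary.ofTower exists_isReal_hodgeModel_holds hodgePQ_independent_of_hodgeModel_holds BallQuotient.ballQuotientUniformised_holds (cmAbelianVarietyRealised_of_eigenbasis exists_isReal_hodgeModel_holds hodgePQ_independent_of_hodgeModel_holds cmAbelianVarietyEigenbasisRealised_holds) Literature.NumberTheory.Transcendental.arapura2012_cor_15_4_6_holds V (I V (repAt a₀) (muLiu ι₁ GramClass.rep))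
      (fun i => {χ : (line V (repAt a₀) (muLiu ι₁ GramClass.rep) i).CharW // (line V (repAt a₀) (muLiu ι₁ GramClass.rep) i).IsAutChar χ})
      (fun i a => (line V (repAt a₀) (muLiu ι₁ GramClass.rep) i).Ω (ιVE V) a.1) (fun i => SplitLine.PhiMuLine ι₁ (line V (repAt a₀) (muLiu ι₁ GramClass.rep) i))
      (fun i dd => dd.IsReflexOfTypeG ((starRingEnd ℂ).comp ι₁) (SplitLine.typeOfLine (line V (repAt a₀) (muLiu ι₁ GramClass.rep) i)))).Thm418C := by
  -- the `(R, hR)` seam: Liu's rest of record at `δ′` IS the uniform rest (own-htheta `restOfCharRep_eq_rest`, `rfl` — paid once, there)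
  have hR : ∀ (i : (I V (repAt a₀) (muLiu ι₁ GramClass.rep))) (μ : Literature.NumberTheory.Automorphic.IdeleClassGroup (F : Type) →ₜ* Circle)
      (hμ : IdeleClassGroup.IsConjugateSymplectic (F : Type) μ) (hw : IdeleClassGroup.HasWeight (F : Type) μ 1),
      (restOfCharDeltaPrimeLine h ⟨F.K⟩ h6 ι₁ (⟨V.Hm, V.isHermitian, V.signature_ι₁, V.posDef_of_ne⟩) Φ e₁ (frameD V) (frameD_real V) (frameD_ne V) (ιVE V) (repAt a₀ (Sigma.fst i)).1
            (repAt a₀ (Sigma.fst i)).2.1 (repAt a₀ (Sigma.fst i)).2.2 μ hμ hw) = ((uniformOmegaRep h ⟨F.K⟩ ι₁ (⟨V.Hm, V.isHermitian, V.signature_ι₁, V.posDef_of_ne⟩) Φ e₁ (frameD V)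
            (frameD_real V) (frameD_ne V) (ιVE V) (2 * imagUnit (HodgeCM.CMField.K F))⁻¹ (fun _ _ => (repOfLine ⟨F.K⟩ (repAt a₀ (Sigma.fst i)).1 (repAt a₀ (Sigma.fst i)).2.1 (repAt a₀
            (Sigma.fst i)).2.2)))).rest (restTailOne (AlgHom.id ℚ _) ι₁ hμ hw (Def45.Carriers.ofPolDR μ (Def45.PolDR ι₁ hμ (Def45.RMuForm ι₁ hμ))) ((heckeTranslatesFamilyOf
            heckeTranslate_definedOver_holds h isoOf ⟨F.K⟩ ι₁ (⟨V.Hm, V.isHermitian, V.signature_ι₁, V.posDef_of_ne⟩) Φ h6).rhoΩOne (AlgHom.id ℚ _) ι₁ hμ hw (Def45.Carriers.ofPolDR μ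
            (Def45.PolDR ι₁ hμ (Def45.RMuForm ι₁ hμ))))) := fun i μ hμ hw =>
    restOfCharRep_eq_rest h ⟨F.K⟩ ι₁ (⟨V.Hm, V.isHermitian, V.signature_ι₁, V.posDef_of_ne⟩) Φ e₁ (frameD V) (frameD_real V) (frameD_ne V) (ιVE V) (2 * imagUnit (F : Type))⁻¹
      (fun _ _ => (repOfLine ⟨F.K⟩ (repAt a₀ (Sigma.fst i)).1 (repAt a₀ (Sigma.fst i)).2.1 (repAt a₀ (Sigma.fst i)).2.2)) h6 μ hμ hw
  -- (b) THE Ω-PIN AT THE INDEX OF RECORD, BY VALUE (prove-7 `OmegaPin.exists_pinTerms_indexOfRecord` over prove-6's `Model.exists_omegaPin_line`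
  --     over ✔ F4; keys from pin-3's X3-Char `Item6CentralTypeAtPinIndex`): the lines' weight-one characters `μ_i` and `σ ∕ e` with `hσ ∕ he`
  obtain ⟨μ, hμ, hw, σ, e, hcm, hσ, he⟩ :=
    HodgeCM.Model.LiuIndex.OmegaPin.exists_pinTerms_indexOfRecord V a₀ (ιVE V) h h6 Φ hV
      (fun i _ _ μ hμ hw => ((uniformOmegaRep h ⟨F.K⟩ ι₁ (⟨V.Hm, V.isHermitian, V.signature_ι₁, V.posDef_of_ne⟩) Φ e₁ (frameD V) (frameD_real V) (frameD_ne V) (ιVE V) (2 * imagUnit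
            (HodgeCM.CMField.K F))⁻¹ (fun _ _ => (repOfLine ⟨F.K⟩ (repAt a₀ (Sigma.fst i)).1 (repAt a₀ (Sigma.fst i)).2.1 (repAt a₀ (Sigma.fst i)).2.2)))).rest (restTailOne (AlgHom.id
            ℚ _) ι₁ hμ hw (Def45.Carriers.ofPolDR μ (Def45.PolDR ι₁ hμ (Def45.RMuForm ι₁ hμ))) ((heckeTranslatesFamilyOf heckeTranslate_definedOver_holds h isoOf ⟨F.K⟩ ι₁ (⟨V.Hm,
            V.isHermitian, V.signature_ι₁, V.posDef_of_ne⟩) Φ h6).rhoΩOne (AlgHom.id ℚ _) ι₁ hμ hw (Def45.Carriers.ofPolDR μ (Def45.PolDR ι₁ hμ (Def45.RMuForm ι₁ hμ)))))) (fun i _ _ μ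
            hμ hw => hR i μ hμ hw)
  -- [Thm 4.18] and [Def 4.11] moved along the seam
  have hLiu' : ∀ (i : (I V (repAt a₀) (muLiu ι₁ GramClass.rep))) (μ : Literature.NumberTheory.Automorphic.IdeleClassGroup (F : Type) →ₜ* Circle)
      (hμ : IdeleClassGroup.IsConjugateSymplectic (F : Type) μ) (hw : IdeleClassGroup.HasWeight (F : Type) μ 1),
      Thm418AsPrinted (toThm418Data _ (((uniformOmegaRep h ⟨F.K⟩ ι₁ (⟨V.Hm, V.isHermitian, V.signature_ι₁, V.posDef_of_ne⟩) Φ e₁ (frameD V) (frameD_real V) (frameD_ne V) (ιVE V) (2 *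
            imagUnit (HodgeCM.CMField.K F))⁻¹ (fun _ _ => (repOfLine ⟨F.K⟩ (repAt a₀ (Sigma.fst i)).1 (repAt a₀ (Sigma.fst i)).2.1 (repAt a₀ (Sigma.fst i)).2.2)))).rest (restTailOne
            (AlgHom.id ℚ _) ι₁ hμ hw (Def45.Carriers.ofPolDR μ (Def45.PolDR ι₁ hμ (Def45.RMuForm ι₁ hμ))) ((heckeTranslatesFamilyOf heckeTranslate_definedOver_holds h isoOf ⟨F.K⟩ ι₁
            (⟨V.Hm, V.isHermitian, V.signature_ι₁, V.posDef_of_ne⟩) Φ h6).rhoΩOne (AlgHom.id ℚ _) ι₁ hμ hw (Def45.Carriers.ofPolDR μ (Def45.PolDR ι₁ hμ (Def45.RMuForm ι₁ hμ))))))) :=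
            fun i μ hμ hw => by
    rw [← hR]; exact hLiu i μ hμ hw
  have h411' : ∀ (i : (I V (repAt a₀) (muLiu ι₁ GramClass.rep))) (μ : Literature.NumberTheory.Automorphic.IdeleClassGroup (F : Type) →ₜ* Circle)
      (hμ : IdeleClassGroup.IsConjugateSymplectic (F : Type) μ) (hw : IdeleClassGroup.HasWeight (F : Type) μ 1),
      Def411AsPrinted (toThm418Data _ (((uniformOmegaRep h ⟨F.K⟩ ι₁ (⟨V.Hm, V.isHermitian, V.signature_ι₁, V.posDef_of_ne⟩) Φ e₁ (frameD V) (frameD_real V) (frameD_ne V) (ιVE V) (2 *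
            imagUnit (HodgeCM.CMField.K F))⁻¹ (fun _ _ => (repOfLine ⟨F.K⟩ (repAt a₀ (Sigma.fst i)).1 (repAt a₀ (Sigma.fst i)).2.1 (repAt a₀ (Sigma.fst i)).2.2)))).rest (restTailOne
            (AlgHom.id ℚ _) ι₁ hμ hw (Def45.Carriers.ofPolDR μ (Def45.PolDR ι₁ hμ (Def45.RMuForm ι₁ hμ))) ((heckeTranslatesFamilyOf heckeTranslate_definedOver_holds h isoOf ⟨F.K⟩ ι₁
            (⟨V.Hm, V.isHermitian, V.signature_ι₁, V.posDef_of_ne⟩) Φ h6).rhoΩOne (AlgHom.id ℚ _) ι₁ hμ hw (Def45.Carriers.ofPolDR μ (Def45.PolDR ι₁ hμ (Def45.RMuForm ι₁ hμ))))))) :=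
            fun i μ hμ hw => by
    rw [← hR]; exact h411R i μ hμ hw
  -- [Lem D.1 (1)] ⟹ `ω ≠ 0` at the rests (✔ F4; the frame transport of record is onto: it is a homeomorphism)
  have hιs : Function.Surjective (ιVE V) :=
    (isHomeomorph_finPart_cmKTypeHom_finAdelicToAdelic (F : Type) V.Hm (frameG V) (frameD V) (frame_congr V)).surjective
  have hnvD : ∀ (i : (I V (repAt a₀) (muLiu ι₁ GramClass.rep))) (μ : Literature.NumberTheory.Automorphic.IdeleClassGroup (F : Type) →ₜ* Circle)
      (hμ : IdeleClassGroup.IsConjugateSymplectic (F : Type) μ) (hw : IdeleClassGroup.HasWeight (F : Type) μ 1)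
      (j : (toThm418Data _ (((uniformOmegaRep h ⟨F.K⟩ ι₁ (⟨V.Hm, V.isHermitian, V.signature_ι₁, V.posDef_of_ne⟩) Φ e₁ (frameD V) (frameD_real V) (frameD_ne V) (ιVE V) (2 * imagUnit
            (HodgeCM.CMField.K F))⁻¹ (fun _ _ => (repOfLine ⟨F.K⟩ (repAt a₀ (Sigma.fst i)).1 (repAt a₀ (Sigma.fst i)).2.1 (repAt a₀ (Sigma.fst i)).2.2)))).rest (restTailOne (AlgHom.id
            ℚ _) ι₁ hμ hw (Def45.Carriers.ofPolDR μ (Def45.PolDR ι₁ hμ (Def45.RMuForm ι₁ hμ))) ((heckeTranslatesFamilyOf heckeTranslate_definedOver_holds h isoOf ⟨F.K⟩ ι₁ (⟨V.Hm,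
            V.isHermitian, V.signature_ι₁, V.posDef_of_ne⟩) Φ h6).rhoΩOne (AlgHom.id ℚ _) ι₁ hμ hw (Def45.Carriers.ofPolDR μ (Def45.PolDR ι₁ hμ (Def45.RMuForm ι₁ hμ))))))).AdmIndex),
      Nontrivial ((toThm418Data _ (((uniformOmegaRep h ⟨F.K⟩ ι₁ (⟨V.Hm, V.isHermitian, V.signature_ι₁, V.posDef_of_ne⟩) Φ e₁ (frameD V) (frameD_real V) (frameD_ne V) (ιVE V) (2 *
            imagUnit (HodgeCM.CMField.K F))⁻¹ (fun _ _ => (repOfLine ⟨F.K⟩ (repAt a₀ (Sigma.fst i)).1 (repAt a₀ (Sigma.fst i)).2.1 (repAt a₀ (Sigma.fst i)).2.2)))).rest (restTailOne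
            (AlgHom.id ℚ _) ι₁ hμ hw (Def45.Carriers.ofPolDR μ (Def45.PolDR ι₁ hμ (Def45.RMuForm ι₁ hμ))) ((heckeTranslatesFamilyOf heckeTranslate_definedOver_holds h isoOf ⟨F.K⟩ ι₁
            (⟨V.Hm, V.isHermitian, V.signature_ι₁, V.posDef_of_ne⟩) Φ h6).rhoΩOne (AlgHom.id ℚ _) ι₁ hμ hw (Def45.Carriers.ofPolDR μ (Def45.PolDR ι₁ hμ (Def45.RMuForm ι₁
            hμ))))))).omegaAt j) := fun i μ hμ hw => by
    rw [← hR]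
    exact fun j => nontrivial_omegaAt_restOfCharDeltaPrime_of_lemD1AsPrinted h ⟨F.K⟩ h6 ι₁ (⟨V.Hm, V.isHermitian, V.signature_ι₁, V.posDef_of_ne⟩) Φ e₁ (frameD V) (frameD_real V)
      (frameD_ne V) (ιVE V) (repOfLine ⟨F.K⟩ (repAt a₀ (Sigma.fst i)).1 (repAt a₀ (Sigma.fst i)).2.1 (repAt a₀ (Sigma.fst i)).2.2) μ hμ hw hιs (le_refl 3) j (hD1 i μ hμ hw j)
  exact Summit.HodgeConjecture.CorCM.D2Bridge.PinSignatures.thm418C_ofTower_of_pins V (ιVE V) (I V (repAt a₀) (muLiu ι₁ GramClass.rep))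
    (fun i => {χ : (line V (repAt a₀) (muLiu ι₁ GramClass.rep) i).CharW // (line V (repAt a₀) (muLiu ι₁ GramClass.rep) i).IsAutChar χ}) (line V (repAt a₀) (muLiu ι₁ GramClass.rep)) (fun _ a => a.1)
    (fun i => SplitLine.PhiMuLine ι₁ (line V (repAt a₀) (muLiu ι₁ GramClass.rep) i))
    (fun i dd => dd.IsReflexOfTypeG ((starRingEnd ℂ).comp ι₁) (SplitLine.typeOfLine (line V (repAt a₀) (muLiu ι₁ GramClass.rep) i)))
    h Φ (sec42DataOf h isoOf ⟨F.K⟩ ι₁ (⟨V.Hm, V.isHermitian, V.signature_ι₁, V.posDef_of_ne⟩) Φ) (fun i => Continuous (i.2.1 : SplittingAt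
          V (repAt a₀ i.1)))
    -- block vanishing at the NON-CONTINUOUS index lines — BY VALUE: a compatible index splitting with a central type and SMOOTH finite Weil
    -- representation is continuous (pin-3 `continuous_of_hasCentralTypeAt_of_smooth`, frame transport open), and at a non-smooth line the block
    -- vanishes (own-htheta `block_pin_lineOf_eq_bot_of_not_smooth`, [GR91 Prop. 3.1.1] discharged by `compatibleSplitting_cmSplittingDatum`)
    (fun i _ hnc => Transposition.BlockVanishing.block_pin_lineOf_eq_bot_of_not_smooth exists_isReal_hodgeModel_holds
        hodgePQ_independent_of_hodgeModel_holds BallQuotient.ballQuotientUniformised_holds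
        (cmAbelianVarietyRealised_of_eigenbasis exists_isReal_hodgeModel_holds hodgePQ_independent_of_hodgeModel_holds
          cmAbelianVarietyEigenbasisRealised_holds)
        Literature.NumberTheory.Transcendental.arapura2012_cor_15_4_6_holds V (repAt a₀) (CentralTypeIs V (muLiu ι₁ GramClass.rep)) i fun hsm =>
      hnc (Transposition.CentralTypeAtPin.continuous_of_hasCentralTypeAt_of_smooth V (repAt a₀ i.1) i.2.1
        (isCompatAt_of_mem V (repAt a₀) (muLiu ι₁ GramClass.rep) i) (hasCentralTypeAt_of_mem V (repAt a₀) (muLiu ι₁ GramClass.rep) i) (ιVE V)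
        (continuous_ιVE V) (isHomeomorph_finPart_cmKTypeHom_finAdelicToAdelic (F : Type) V.Hm (frameG V) (frameD V) (frame_congr V)).isOpenMap
        hsm.1 hsm.2))
    -- (a) U ∕ R₀ ∕ tail ∕ hLiu — BY VALUE
    (fun i _ _ => (uniformOmegaRep h ⟨F.K⟩ ι₁ (⟨V.Hm, V.isHermitian, V.signature_ι₁, V.posDef_of_ne⟩) Φ e₁ (frameD V) (frameD_real V) (frameD_ne V) (ιVE V) (2 * imagUnit
          (HodgeCM.CMField.K F))⁻¹ (fun _ _ => (repOfLine ⟨F.K⟩ (repAt a₀ (Sigma.fst i)).1 (repAt a₀ (Sigma.fst i)).2.1 (repAt a₀ (Sigma.fst i)).2.2))))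
    (fun i hi hg => ((uniformOmegaRep h ⟨F.K⟩ ι₁ (⟨V.Hm, V.isHermitian, V.signature_ι₁, V.posDef_of_ne⟩) Φ e₁ (frameD V) (frameD_real V) (frameD_ne V) (ιVE V) (2 * imagUnit
          (HodgeCM.CMField.K F))⁻¹ (fun _ _ => (repOfLine ⟨F.K⟩ (repAt a₀ (Sigma.fst i)).1 (repAt a₀ (Sigma.fst i)).2.1 (repAt a₀ (Sigma.fst i)).2.2)))).rest (restTailOne (AlgHom.id ℚ
          _) ι₁ (hμ i hi hg) (hw i hi hg) (Def45.Carriers.ofPolDR (μ i hi hg) (Def45.PolDR ι₁ (hμ i hi hg) (Def45.RMuForm ι₁ (hμ i hi hg)))) ((heckeTranslatesFamilyOf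
          heckeTranslate_definedOver_holds h isoOf ⟨F.K⟩ ι₁ (⟨V.Hm, V.isHermitian, V.signature_ι₁, V.posDef_of_ne⟩) Φ h6).rhoΩOne (AlgHom.id ℚ _) ι₁ (hμ i hi hg) (hw i hi hg)
          (Def45.Carriers.ofPolDR (μ i hi hg) (Def45.PolDR ι₁ (hμ i hi hg) (Def45.RMuForm ι₁ (hμ i hi hg)))))))
    (fun i hi hg => (restTailOne (AlgHom.id ℚ _) ι₁ (hμ i hi hg) (hw i hi hg) (Def45.Carriers.ofPolDR (μ i hi hg) (Def45.PolDR ι₁ (hμ i hi hg) (Def45.RMuForm ι₁ (hμ i hi hg))))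
          ((heckeTranslatesFamilyOf heckeTranslate_definedOver_holds h isoOf ⟨F.K⟩ ι₁ (⟨V.Hm, V.isHermitian, V.signature_ι₁, V.posDef_of_ne⟩) Φ h6).rhoΩOne (AlgHom.id ℚ _) ι₁ (hμ i hi
          hg) (hw i hi hg) (Def45.Carriers.ofPolDR (μ i hi hg) (Def45.PolDR ι₁ (hμ i hi hg) (Def45.RMuForm ι₁ (hμ i hi hg)))))))
    (fun i hi hg => hLiu' i (μ i hi hg) (hμ i hi hg) (hw i hi hg))
    -- (b) the Ω-pin
    σ hσ e he
    -- (c) the J-record pin — BY VALUE (✔ `JRecordSocketByValue`) at the characters of the Ω-pin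
    (fun i hi hg => socketM F h6 V a₀ h Φ h21 i (μ i hi hg) (hμ i hi hg) (hw i hi hg))
    (fun i hi hg => socketJH F h6 V a₀ h Φ h21 i (μ i hi hg) (hμ i hi hg) (hw i hi hg))
    (fun i hi hg => socketJH_injective F h6 V a₀ h Φ h21 i (μ i hi hg) (hμ i hi hg) (hw i hi hg))
    (fun i hi hg => socketJH_comm F h6 V a₀ h Φ h21 i (μ i hi hg) (hμ i hi hg) (hw i hi hg))
    -- (d) the pieces below the App-C threshold — BY VALUE (§1) at the Ω-pin's key `HasCMType μ_i (line i).lineType`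
    (fun _ => (HodgeCM.Level.capThree (V := V) (((sec42DataOf h isoOf ⟨F.K⟩ ι₁ (⟨V.Hm, V.isHermitian, V.signature_ι₁, V.posDef_of_ne⟩) Φ)).S.K₀.1 : Subgroup ↥(HodgeCM.HermSpace3.adelicFin V)) ((sec42DataOf h isoOf ⟨F.K⟩ ι₁ (⟨V.Hm, V.isHermitian, V.signature_ι₁, V.posDef_of_ne⟩) Φ)).S.K₀.2.1))
    (fun i hi hg K hK => Classical.choice (nonempty_socketPieces_conjAdm F h6 V a₀ h Φ h21 i (μ i hi hg) (hμ i hi hg) (hw i hi hg) (hcm i hi hg) K hK))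
    -- [Lem D.1 (1)], [Prop 4.13], [Def 4.11], [Thm 4.18 (2)] ∕ [Lem D.1 (3)] — BY VALUE from the displayed as-printed families
    (fun i hi hg j => hnvD i (μ i hi hg) (hμ i hi hg) (hw i hi hg) j) (fun i _ _ => h413 i)
    (fun i _ _ => ((uniformOmegaRep h ⟨F.K⟩ ι₁ (⟨V.Hm, V.isHermitian, V.signature_ι₁, V.posDef_of_ne⟩) Φ e₁ (frameD V) (frameD_real V) (frameD_ne V) (ιVE V) (2 * imagUnit
          (HodgeCM.CMField.K F))⁻¹ (fun _ _ => (repOfLine ⟨F.K⟩ (repAt a₀ (Sigma.fst i)).1 (repAt a₀ (Sigma.fst i)).2.1 (repAt a₀ (Sigma.fst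
          i)).2.2)))).adjectives_rhoAt_prop413Data_of_def411AsPrinted_rest _
      (fun μ hμ hw => (restTailOne (AlgHom.id ℚ _) ι₁ hμ hw (Def45.Carriers.ofPolDR μ (Def45.PolDR ι₁ hμ (Def45.RMuForm ι₁ hμ))) ((heckeTranslatesFamilyOf
            heckeTranslate_definedOver_holds h isoOf ⟨F.K⟩ ι₁ (⟨V.Hm, V.isHermitian, V.signature_ι₁, V.posDef_of_ne⟩) Φ h6).rhoΩOne (AlgHom.id ℚ _) ι₁ hμ hw (Def45.Carriers.ofPolDR μ
            (Def45.PolDR ι₁ hμ (Def45.RMuForm ι₁ hμ)))))) (h411' i))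
    (fun i _ _ => ((uniformOmegaRep h ⟨F.K⟩ ι₁ (⟨V.Hm, V.isHermitian, V.signature_ι₁, V.posDef_of_ne⟩) Φ e₁ (frameD V) (frameD_real V) (frameD_ne V) (ιVE V) (2 * imagUnit
          (HodgeCM.CMField.K F))⁻¹ (fun _ _ => (repOfLine ⟨F.K⟩ (repAt a₀ (Sigma.fst i)).1 (repAt a₀ (Sigma.fst i)).2.1 (repAt a₀ (Sigma.fst
          i)).2.2)))).admTriple_eq_of_areIsomorphic_of_thm418AsPrinted_rest _
      (fun μ hμ hw => (restTailOne (AlgHom.id ℚ _) ι₁ hμ hw (Def45.Carriers.ofPolDR μ (Def45.PolDR ι₁ hμ (Def45.RMuForm ι₁ hμ))) ((heckeTranslatesFamilyOf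
            heckeTranslate_definedOver_holds h isoOf ⟨F.K⟩ ι₁ (⟨V.Hm, V.isHermitian, V.signature_ι₁, V.posDef_of_ne⟩) Φ h6).rhoΩOne (AlgHom.id ℚ _) ι₁ hμ hw (Def45.Carriers.ofPolDR μ
            (Def45.PolDR ι₁ hμ (Def45.RMuForm ι₁ hμ)))))) (hLiu' i) (hμsep i))
    -- `hK`: a model level is open compact — BY VALUE
    ⟨((HodgeCM.Level.capThree (V := V) (((sec42DataOf h isoOf ⟨F.K⟩ ι₁ (⟨V.Hm, V.isHermitian, V.signature_ι₁, V.posDef_of_ne⟩) Φ)).S.K₀.1 : Subgroup ↥(HodgeCM.HermSpace3.adelicFin V))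
          ((sec42DataOf h isoOf ⟨F.K⟩ ι₁ (⟨V.Hm, V.isHermitian, V.signature_ι₁, V.posDef_of_ne⟩) Φ)).S.K₀.2.1)).K, ((HodgeCM.Level.capThree (V := V) (((sec42DataOf h isoOf ⟨F.K⟩ ι₁
          (⟨V.Hm, V.isHermitian, V.signature_ι₁, V.posDef_of_ne⟩) Φ)).S.K₀.1 : Subgroup ↥(HodgeCM.HermSpace3.adelicFin V)) ((sec42DataOf h isoOf ⟨F.K⟩ ι₁ (⟨V.Hm, V.isHermitian,
          V.signature_ι₁, V.posDef_of_ne⟩) Φ)).S.K₀.2.1)).isOpen_K, ((HodgeCM.Level.capThree (V := V) (((sec42DataOf h isoOf ⟨F.K⟩ ι₁ (⟨V.Hm, V.isHermitian, V.signature_ι₁,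
          V.posDef_of_ne⟩) Φ)).S.K₀.1 : Subgroup ↥(HodgeCM.HermSpace3.adelicFin V)) ((sec42DataOf h isoOf ⟨F.K⟩ ι₁ (⟨V.Hm, V.isHermitian, V.signature_ι₁, V.posDef_of_ne⟩)
          Φ)).S.K₀.2.1)).isCompact_K⟩

end Summit.HodgeConjecture.CorCM.D2Bridge

end
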